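import Mathlib
import Summits.Ventures.PercRepro2.OneEdge
import Summits.Ventures.PercRepro2.TypedMarkedSeriesDefs
import Summits.Ventures.PercRepro2.TypedMarkedSeriesGraph
import Summits.Ventures.PercRepro2.TypedMarkedSeriesStateCD
import Summits.Ventures.PercRepro2.TypedCoincRootEdge

/-!
# The state lemma of the marked star `b ~ {a₁, a₂, o}` (blind cell PercRepro2, night-3 g14,
2026-08-27; `proofs/NIGHT3-CERT.md` §23.11)

`st_modelT`: when `b` carries exactly the edges `e = {a₁, b}` (bit `p`), `f = {b, a₂}` (bit `a`) and
`g = {b, o}` (bit `u`), the state of `x[e ↦ p][f ↦ a][g ↦ u]` is an explicit Boolean function of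
the signature of `x`: with `g` closed it is `modelD` (`st_modelD`); opening `g` joins the cluster of
`b` with that of `o` (`conn_update_true_iff`) — the `o ↔ b` twin of `st_modelS`.  Nothing here
asserts anything about the original lane.
-/

namespace Summit.Ventures.PercRepro2

open UnionCluster

namespace CovForm

namespace MarkedSeries

open OneTyped TypedA3 Untouched TypedRed

section StateLemma

open Classical

variable {V : Type*} {E : Type*} [DecidableEq E]
variable (ends : E → Sym2 V) (o a₁ a₂ a₃ b : V)

/-- **State lemma T**: `b` with exactly the edges `e = {a₁, b}`, `f = {b, a₂}`, `g = {b, o}`. -/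
lemma st_modelT {e f g : E} (hef : e ≠ f) (heg : e ≠ g) (hfg : f ≠ g) (he : ends e = s(a₁, b))
    (hf : ends f = s(b, a₂)) (hg : ends g = s(b, o)) (hb1 : b ≠ a₁) (hb2 : b ≠ a₂) (hb3 : b ≠ a₃)
    (hbo : b ≠ o) (x : Config E) (hxe : x e = false) (hxf : x f = false) (hxg : x g = false)
    (hother : ∀ e', e' ≠ e → e' ≠ f → e' ≠ g → b ∈ ends e' → x e' = false) (p a u : Bool) :
    st ends o a₁ a₂ a₃ b (Function.update (Function.update (Function.update x e p) f a) g u) =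
      (if u then ((modelD (decide (Conn ends x a₁ a₂)) (decide (Conn ends x a₁ o)) (decide (Conn ends x a₁ a₃)) (decide (Conn ends x a₂ o)) (decide (Conn ends x a₂ a₃)) (decide (Conn ends x o a₃)) p a).q' || ((modelD (decide (Conn ends x a₁ a₂)) (decide (Conn ends x a₁ o)) (decide (Conn ends x a₁ a₃)) (decide (Conn ends x a₂ o)) (decide (Conn ends x a₂ a₃)) (decide (Conn ends x o a₃)) p a).Hb && (modelD (decide (Conn ends x a₁ a₂)) (decide (Conn ends x a₁ o)) (decide (Conn ends x a₁ a₃)) (decide (Conn ends x a₂ o)) (decide (Conn ends x a₂ a₃)) (decide (Conn ends x o a₃)) p a).Lo) || ((modelD (decide (Conn ends x a₁ a₂)) (decide (Conn ends x a₁ o)) (decide (Conn ends x a₁ a₃)) (decide (Conn ends x a₂ o)) (decide (Conn ends x a₂ a₃)) (decide (Conn ends x o a₃)) p a).Ho && (modelD (decide (Conn ends x a₁ a₂)) (decide (Conn ends x a₁ o)) (decide (Conn ends x a₁ a₃)) (decide (Conn ends x a₂ o)) (decide (Conn ends x a₂ a₃)) (decide (Conn ends x o a₃)) p a).Lb), (modelD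 (decide (Conn ends x a₁ a₂)) (decide (Conn ends x a₁ o)) (decide (Conn ends x a₁ a₃)) (decide (Conn ends x a₂ o)) (decide (Conn ends x a₂ a₃)) (decide (Conn ends x o a₃)) p a).Lo || (modelD (decide (Conn ends x a₁ a₂)) (decide (Conn ends x a₁ o)) (decide (Conn ends x a₁ a₃)) (decide (Conn ends x a₂ o)) (decide (Conn ends x a₂ a₃)) (decide (Conn ends x o a₃)) p a).Lb, (modelD (decide (Conn ends x a₁ a₂)) (decide (Conn ends x a₁ o)) (decide (Conn ends x a₁ a₃)) (decide (Conn ends x a₂ o)) (decide (Conn ends x a₂ a₃)) (decide (Conn ends x o a₃)) p a).Ho || (modelD (decide (Conn ends x a₁ a₂)) (decide (Conn ends x a₁ o)) (decide (Conn ends x a₁ a₃)) (decide (Conn ends x a₂ o)) (decide (Conn ends x a₂ a₃)) (decide (Conn ends x o a₃)) p a).Hb, (modelD (decide (Conn ends x a₁ a₂)) (decide (Conn ends x a₁ o)) (decide (Conn ends x a₁ a₃)) (decide (Conn ends x a₂ o)) (decide (Conn ends x a₂ a₃)) (decide (Conn ends x o a₃)) p a).Lb || (modelD (decide (Conn ends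 x a₁ a₂)) (decide (Conn ends x a₁ o)) (decide (Conn ends x a₁ a₃)) (decide (Conn ends x a₂ o)) (decide (Conn ends x a₂ a₃)) (decide (Conn ends x o a₃)) p a).Lo, (modelD (decide (Conn ends x a₁ a₂)) (decide (Conn ends x a₁ o)) (decide (Conn ends x a₁ a₃)) (decide (Conn ends x a₂ o)) (decide (Conn ends x a₂ a₃)) (decide (Conn ends x o a₃)) p a).Hb || (modelD (decide (Conn ends x a₁ a₂)) (decide (Conn ends x a₁ o)) (decide (Conn ends x a₁ a₃)) (decide (Conn ends x a₂ o)) (decide (Conn ends x a₂ a₃)) (decide (Conn ends x o a₃)) p a).Ho, (modelD (decide (Conn ends x a₁ a₂)) (decide (Conn ends x a₁ o)) (decide (Conn ends x a₁ a₃)) (decide (Conn ends x a₂ o)) (decide (Conn ends x a₂ a₃)) (decide (Conn ends x o a₃)) p a).L3 || ((modelD (decide (Conn ends x a₁ a₂)) (decide (Conn ends x a₁ o)) (decide (Conn ends x a₁ a₃)) (decide (Conn ends x a₂ o)) (decide (Conn ends x a₂ a₃)) (decide (Conn ends x o a₃)) p a).Lb && ((decide (Conn ends x o a₃)) || (p &&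 a && ((decide (Conn ends x a₁ o)) || (decide (Conn ends x a₂ o))) && ((decide (Conn ends x a₁ a₃)) || (decide (Conn ends x a₂ a₃)))))) || ((modelD (decide (Conn ends x a₁ a₂)) (decide (Conn ends x a₁ o)) (decide (Conn ends x a₁ a₃)) (decide (Conn ends x a₂ o)) (decide (Conn ends x a₂ a₃)) (decide (Conn ends x o a₃)) p a).Lo && ((p && (modelD (decide (Conn ends x a₁ a₂)) (decide (Conn ends x a₁ o)) (decide (Conn ends x a₁ a₃)) (decide (Conn ends x a₂ o)) (decide (Conn ends x a₂ a₃)) (decide (Conn ends x o a₃)) p a).L3) || (a && (modelD (decide (Conn ends x a₁ a₂)) (decide (Conn ends x a₁ o)) (decide (Conn ends x a₁ a₃)) (decide (Conn ends x a₂ o)) (decide (Conn ends x a₂ a₃)) (decide (Conn ends x o a₃)) p a).H3))), (modelD (decide (Conn ends x a₁ a₂)) (decide (Conn ends x a₁ o)) (decide (Conn ends x a₁ a₃)) (decide (Conn ends x a₂ o)) (decide (Conn ends x a₂ a₃)) (decide (Conn ends x o a₃)) p a).H3 || ((modelD (decide (Conn ends x a₁ a₂)) (decide (Conn ends x a₁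 o)) (decide (Conn ends x a₁ a₃)) (decide (Conn ends x a₂ o)) (decide (Conn ends x a₂ a₃)) (decide (Conn ends x o a₃)) p a).Hb && ((decide (Conn ends x o a₃)) || (p && a && ((decide (Conn ends x a₁ o)) || (decide (Conn ends x a₂ o))) && ((decide (Conn ends x a₁ a₃)) || (decide (Conn ends x a₂ a₃)))))) || ((modelD (decide (Conn ends x a₁ a₂)) (decide (Conn ends x a₁ o)) (decide (Conn ends x a₁ a₃)) (decide (Conn ends x a₂ o)) (decide (Conn ends x a₂ a₃)) (decide (Conn ends x o a₃)) p a).Ho && ((p && (modelD (decide (Conn ends x a₁ a₂)) (decide (Conn ends x a₁ o)) (decide (Conn ends x a₁ a₃)) (decide (Conn ends x a₂ o)) (decide (Conn ends x a₂ a₃)) (decide (Conn ends x o a₃)) p a).L3) || (a && (modelD (decide (Conn ends x a₁ a₂)) (decide (Conn ends x a₁ o)) (decide (Conn ends x a₁ a₃)) (decide (Conn ends x a₂ o)) (decide (Conn ends x a₂ a₃)) (decide (Conn ends x o a₃)) p a).H3)))) else (modelD (decide (Conn ends x a₁ a₂)) (decide (Conn ends x a₁ o)) (decide (Conn ends x a₁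 a₃)) (decide (Conn ends x a₂ o)) (decide (Conn ends x a₂ a₃)) (decide (Conn ends x o a₃)) p a)) := by
  have hother' : ∀ e', e' ≠ e → e' ≠ f → b ∈ ends e' → x e' = false := fun e' h1 h2 hb' => by
    by_cases h3 : e' = g
    · rw [h3]; exact hxg
    · exact hother e' h1 h2 h3 hb'
  set x₁ := Function.update (Function.update x e p) f a with hx₁
  have ux : Function.update (Function.update x e false) f false = x := by
    funext e'
    by_cases h1 : e' = f
    · subst h1
      rw [Function.update_self, hxf]
    · rw [Function.update_of_ne h1]
      by_cases h2 : e' = e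
      · subst h2
        rw [Function.update_self, hxe]
      · rw [Function.update_of_ne h2]
  have hC : st ends o a₁ a₂ a₃ b x₁ = modelD (decide (Conn ends x a₁ a₂)) (decide (Conn ends x a₁ o))
      (decide (Conn ends x a₁ a₃)) (decide (Conn ends x a₂ o)) (decide (Conn ends x a₂ a₃))
      (decide (Conn ends x o a₃)) p a := by
    have h := st_modelD ends o a₁ a₂ a₃ b hef he hf hb1 hb2 hb3 hbo x hother' p a
    rw [ux] at h
    exact h
  set mc := modelD (decide (Conn ends x a₁ a₂)) (decide (Conn ends x a₁ o))
      (decide (Conn ends x a₁ a₃)) (decide (Conn ends x a₂ o)) (decide (Conn ends x a₂ a₃))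
      (decide (Conn ends x o a₃)) p a with hmc
  clear_value mc
  have hx₁g : x₁ g = false := by
    rw [hx₁, Function.update_of_ne hfg.symm, Function.update_of_ne heg.symm, hxg]
  cases u
  · have h0 : Function.update x₁ g false = x₁ := by
      rw [show (false : Bool) = x₁ g from hx₁g.symm, Function.update_eq_self]
    simp only [Bool.false_eq_true, if_false]
    rw [h0, hC]
  · simp only [if_true]
    have off := fun {s t : V} (hs : s ≠ b) (ht : t ≠ b) =>
      conn_off_mid hef he hf hb1 hb2 x hother' p a hs ht
    have mid := fun {s : V} (hs : s ≠ b) => conn_mid_iff hef he hf hb1 hb2 x hother' p a hs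
    rw [ux] at off
    have cq : Conn ends x₁ a₂ a₁ ↔ mc.q' = true := by
      rw [← hC]; unfold st St.q'; simp only [decide_eq_true_eq]
    have cLo : Conn ends x₁ a₁ o ↔ mc.Lo = true := by
      rw [← hC]; unfold st St.Lo; simp only [decide_eq_true_eq]
    have cHo : Conn ends x₁ a₂ o ↔ mc.Ho = true := by
      rw [← hC]; unfold st St.Ho; simp only [decide_eq_true_eq]
    have cLb : Conn ends x₁ a₁ b ↔ mc.Lb = true := by
      rw [← hC]; unfold st St.Lb; simp only [decide_eq_true_eq]
    have cHb : Conn ends x₁ a₂ b ↔ mc.Hb = true := by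
      rw [← hC]; unfold st St.Hb; simp only [decide_eq_true_eq]
    have cL3 : Conn ends x₁ a₁ a₃ ↔ mc.L3 = true := by
      rw [← hC]; unfold st St.L3; simp only [decide_eq_true_eq]
    have cH3 : Conn ends x₁ a₂ a₃ ↔ mc.H3 = true := by
      rw [← hC]; unfold st St.H3; simp only [decide_eq_true_eq]
    -- the two further connections: `o ~ a₃` off the mark, `b ~ a₃` through the mark
    have cO3 : Conn ends x₁ o a₃ ↔ (decide (Conn ends x o a₃) ||
        (p && a && (decide (Conn ends x a₁ o) || decide (Conn ends x a₂ o)) &&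
          (decide (Conn ends x a₁ a₃) || decide (Conn ends x a₂ a₃)))) = true := by
      rw [off hbo.symm hb3.symm]
      simp only [Bool.or_eq_true, Bool.and_eq_true, decide_eq_true_eq]
      constructor
      · rintro (h | ⟨hm, h1, h2⟩)
        · exact Or.inl h
        · refine Or.inr ⟨⟨hm, ?_⟩, ?_⟩
          · rcases h1 with h1 | h1
            · exact Or.inl (conn_symm h1)
            · exact Or.inr (conn_symm h1)
          · rcases h2 with h2 | h2
            · exact Or.inl (conn_symm h2)
            · exact Or.inr (conn_symm h2)
      · rintro (h | ⟨⟨hm, h1⟩, h2⟩)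
        · exact Or.inl h
        · refine Or.inr ⟨hm, ?_, ?_⟩
          · rcases h1 with h1 | h1
            · exact Or.inl (conn_symm h1)
            · exact Or.inr (conn_symm h1)
          · rcases h2 with h2 | h2
            · exact Or.inl (conn_symm h2)
            · exact Or.inr (conn_symm h2)
    have cB3 : Conn ends x₁ b a₃ ↔ ((p && mc.L3) || (a && mc.H3)) = true := by
      have h := mid hb3.symm
      simp only [Bool.or_eq_true, Bool.and_eq_true]
      rw [← cL3, ← cH3]
      constructor
      · intro h'
        rcases h.1 (conn_symm h') with ⟨hp, h1⟩ | ⟨ha, h1⟩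
        · exact Or.inl ⟨hp, conn_symm h1⟩
        · exact Or.inr ⟨ha, conn_symm h1⟩
      · rintro (⟨hp, h1⟩ | ⟨ha, h1⟩)
        · exact conn_symm (h.2 (Or.inl ⟨hp, conn_symm h1⟩))
        · exact conn_symm (h.2 (Or.inr ⟨ha, conn_symm h1⟩))
    have cOb : Conn ends x₁ o b ↔ ((p && mc.Lo) || (a && mc.Ho)) = true := by
      have h := mid hbo.symm
      simp only [Bool.or_eq_true, Bool.and_eq_true]
      rw [← cLo, ← cHo]
      constructor
      · intro h'
        rcases h.1 h' with ⟨hp, h1⟩ | ⟨ha, h1⟩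
        · exact Or.inl ⟨hp, conn_symm h1⟩
        · exact Or.inr ⟨ha, conn_symm h1⟩
      · rintro (⟨hp, h1⟩ | ⟨ha, h1⟩)
        · exact h.2 (Or.inl ⟨hp, conn_symm h1⟩)
        · exact h.2 (Or.inr ⟨ha, conn_symm h1⟩)
    have upd := fun (s t : V) => OneEdge.conn_update_true_iff hg x₁ s t
    have sym : ∀ s t : V, Conn ends x₁ s t ↔ Conn ends x₁ t s := fun s t => ⟨conn_symm, conn_symm⟩
    have roo : Conn ends x₁ o o := conn_refl ends x₁ o
    have rbb : Conn ends x₁ b b := conn_refl ends x₁ b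
    unfold st
    simp only [Prod.mk.injEq]
    refine ⟨?_, ?_, ?_, ?_, ?_, ?_, ?_⟩
    · apply Bool.eq_iff_iff.mpr
      simp only [decide_eq_true_eq]
      rw [upd, sym o a₁, sym b a₁, cq, cHb, cLo, cHo, cLb]
      simp only [Bool.or_eq_true, Bool.and_eq_true]
      clear hmc hC off mid upd sym cq cLo cHo cLb cHb cL3 cH3 cO3 cB3 cOb hother hother' ux hx₁ hx₁g roo rbb
      tauto
    · apply Bool.eq_iff_iff.mpr
      simp only [decide_eq_true_eq]
      rw [upd, cLo, cLb, sym b o, cOb]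
      simp only [roo, and_true, Bool.or_eq_true, Bool.and_eq_true]
      clear hmc hC off mid upd sym cq cLo cHo cLb cHb cL3 cH3 cO3 cB3 cOb hother hother' ux hx₁ hx₁g roo rbb
      tauto
    · apply Bool.eq_iff_iff.mpr
      simp only [decide_eq_true_eq]
      rw [upd, cHo, cHb, sym b o, cOb]
      simp only [roo, and_true, Bool.or_eq_true, Bool.and_eq_true]
      clear hmc hC off mid upd sym cq cLo cHo cLb cHb cL3 cH3 cO3 cB3 cOb hother hother' ux hx₁ hx₁g roo rbb
      tauto
    · apply Bool.eq_iff_iff.mpr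
      simp only [decide_eq_true_eq]
      rw [upd, cLb, cLo, cOb]
      simp only [rbb, and_true, Bool.or_eq_true, Bool.and_eq_true]
      clear hmc hC off mid upd sym cq cLo cHo cLb cHb cL3 cH3 cO3 cB3 cOb hother hother' ux hx₁ hx₁g roo rbb
      tauto
    · apply Bool.eq_iff_iff.mpr
      simp only [decide_eq_true_eq]
      rw [upd, cHb, cHo, cOb]
      simp only [rbb, and_true, Bool.or_eq_true, Bool.and_eq_true]
      clear hmc hC off mid upd sym cq cLo cHo cLb cHb cL3 cH3 cO3 cB3 cOb hother hother' ux hx₁ hx₁g roo rbb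
      tauto
    · apply Bool.eq_iff_iff.mpr
      simp only [decide_eq_true_eq]
      rw [upd, cL3, cLb, cO3, cLo, cB3]
      simp only [Bool.or_eq_true, Bool.and_eq_true, decide_eq_true_eq]
      exact or_assoc.symm
    · apply Bool.eq_iff_iff.mpr
      simp only [decide_eq_true_eq]
      rw [upd, cH3, cHb, cO3, cHo, cB3]
      simp only [Bool.or_eq_true, Bool.and_eq_true, decide_eq_true_eq]
      exact or_assoc.symm

end StateLemma

end MarkedSeries

end CovForm

end Summit.Ventures.PercRepro2
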